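import Literature.Analysis.FluidPDE.SereginSverakBlowupAlternativeAssembly
import Literature.Analysis.FluidPDE.NSBoundedHigherRegularityQuant
import Literature.Analysis.FluidPDE.SereginSverakPressureDecayBalls
import HarnessLib

/-!
# Seregin–Šverák 2009, §4: the uniform Hölder bound, the blow-up alternative and Theorem 3.2
# from the interior regularity of bounded solutions with the dependence of the norms (§2 p. 8)

Analysis/FluidPDE proofs file (theorems only; no definitions, no named facts).

G. Seregin, V. Šverák, *On Type I singularities of the local axi-symmetric solutions of the
Navier–Stokes equations*, Comm. PDE 34 (2009) 171–201 = arXiv:0804.1803. The blow-up step of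
§4 (arXiv p. 11) is vendored as the named fact `SereginSverak2009.BlowupAlternative`
(`SereginSverakAxisymmetric.lean`); after the discharges recorded in
`SereginSverakBlowupAlternativeAssembly.lean` its trust base is the single analytic input
`SereginSverak2009.LocalHolderBound` (`SereginSverakBlowup.lean`): "sequence `u^k` is uniformly
bounded in the parabolic Hölder space `C^{1/2}(Q̄(a/2))`" for Navier–Stokes solutions with
`|u^k| ≤ 1` on `Q(4a)` and `‖p^k‖_{3/2,Q(4a)}` bounded — there reduced to the local theory of the
Stokes system (Seregin 2014, Prop. 6.7, `StokesLocalW21Estimate`), which is how p. 11 argues.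

The paper states the same uniform bound a second time, as a property of ALL essentially bounded
distributional solutions, in §2 p. 8 (the passage §4 ¶1 appeals to: "we may also assume that
function `v` is Hölder continuous in the completion of `𝒞 × ]-1,-a²[`"): "for any natural `k`,
`z = (x,t) ↦ ∇ᵏv(z)` is Hölder continuous in `Q̄₂` … **The corresponding norms are estimated by
constants depending on `‖v‖_{3,Q}`, `‖q‖_{3/2,Q}`, `‖v‖_{∞,Q₁}`, and numbers
`k, r₁, r₂, a₂, τ₂`.**" That sentence is the named fact
`Literature.Analysis.FluidPDE.NSBoundedHigherRegularityBounds` (`NSBoundedHigherRegularityQuant.lean`,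
whose docstring names `LocalHolderBound` as its `k = 0` instance). This file records the
elementary reduction, everything proved:

* `localHolderBound_of_higherRegularityBounds : NSBoundedHigherRegularityBounds → LocalHolderBound`
  — the case `k = 0` on the ball cylinder `Q((0,0), 4a) ⊆ 𝒞(4a) × ]-16a², 0[` with data bounds
  `M = 1`, `P = c`, read on `Q(a/2) = 𝒞(a/2) × ]-a²/4, 0[ ⊆ Q((0,0), a/√2)`;
* hence `BlowupCompactness`, `BlowupAlternative`, `BlowupAlternativeTypeI` and Theorem 3.2
  (`isRegularAtOrigin_of_axisDecay_of_higherRegularityBounds`, with the discharged Liouville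
  theorem KNSS 2009 Thm. 5.3) from `NSBoundedHigherRegularityBounds` alone, through the accepted
  assemblies `blowupCompactness_of_localHolderBound`, `blowupAlternative_of_library_facts`
  (with the theorem `NSBoundedSpatialHolder_holds`), `blowupAlternativeTypeI_of_localHolderBound'`
  and `isRegularAtOrigin_of_axisDecay_of_library_facts`.

So `BlowupAlternative` has two independent one-fact trust bases, `{StokesLocalW21Estimate}`
(Seregin 2014, Prop. 6.7; `blowupAlternative_of_stokesLocalW21Estimate`) and
`{NSBoundedHigherRegularityBounds}` (Seregin–Šverák 2009, §2 p. 8; this file), and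
`BlowupAlternative_holds` is a one-liner from whichever `_holds` theorem lands first.

## References

* G. Seregin, V. Šverák, Comm. PDE 34 (2009) 171–201 = arXiv:0804.1803: §2 p. 8 (regularity of
  bounded solutions, norms estimated by the data), §3 Thm. 3.2, §4 p. 11 ((p1)–(p12) and the
  uniform Hölder bound). [`SereginSverak2009`]
* G. Koch, N. Nadirashvili, G. Seregin, V. Šverák, Acta Math. 203 (2009), Thm. 5.3.
  [`KochNadirashviliSereginSverak2009`]
-/

noncomputable section

open MeasureTheory Set Function Filter Topology TopologicalSpace Metric
open scoped NNReal ENNReal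

namespace Literature.Analysis.FluidPDE

namespace SereginSverak2009

/-! ### Hölder bounds for `D⁰_x V` are Hölder bounds for `V` -/

/-- A Hölder bound for `w ↦ D_x⁰ V(w)` (the format of `NSBoundedHigherRegularityBounds` at order
`n = 0`) is a Hölder bound for `uncurry V` with the same constants: `iteratedFDeriv ℝ 0 f x` is
the image of `f x` under a linear isometry (Mathlib `iteratedFDeriv_zero_eq_comp`). [folklore] -/
theorem holderOnWith_uncurry_of_iteratedFDeriv_zero {C α : ℝ≥0}
    {V : ℝ → EuclideanSpace ℝ (Fin 3) → EuclideanSpace ℝ (Fin 3)}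
    {s : Set (ℝ × EuclideanSpace ℝ (Fin 3))}
    (h : HolderOnWith C α
      (fun w : ℝ × EuclideanSpace ℝ (Fin 3) => iteratedFDeriv ℝ 0 (V w.1) w.2) s) :
    HolderOnWith C α (uncurry V) s := by
  intro x hx y hy
  have key := h x hx y hy
  simp only [iteratedFDeriv_zero_eq_comp, comp_apply, LinearIsometryEquiv.edist_map] at key
  exact key

/-! ### `LocalHolderBound` from §2 p. 8 with the dependence of the norms -/

/-- **The uniform local Hölder bound of §4 (`LocalHolderBound`) from the interior regularity of
bounded solutions with the printed dependence of the norms (`NSBoundedHigherRegularityBounds`,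
Seregin–Šverák 2009, §2 p. 8), case `k = 0`.** Given `a > 0` and the pressure bound `c`, take the
constants of `NSBoundedHigherRegularityBounds` for the data `R = 4a`, `M = 1`, `P = c` at order
`0` and inner radius `r = a/√2 = √2 · (a/2)`. For a solution on `Q(4a) = 𝒞(4a) × ]-16a², 0[` with
`|u| ≤ 1` and `∫∫ |p|^{3/2} ≤ c` the hypotheses hold on the ball cylinder
`Q((0,0), 4a) ⊆ Q(4a)` (`B(0,4a) ⊆ 𝒞(4a)`), and the conclusion on `Q((0,0), r)` restricts to
`Q(a/2) = 𝒞(a/2) × ]-a²/4, 0[ ⊆ Q((0,0), r)` (`𝒞(ρ) ⊆ B(0, √2 ρ)`). The constants depend on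
`a` and `c` only, as `LocalHolderBound` demands ("uniformly bounded in the parabolic Hölder
space", §4 p. 11).
[cite: SereginSverak2009, §2 p. 8 (norms of ∇ᵏv on Q̄₂ estimated by ‖v‖_{3,Q}, ‖q‖_{3/2,Q}, ‖v‖_{∞,Q₁}; k = 0) and §4 p. 11 (its use on the blow-up sequence)] -/
theorem localHolderBound_of_higherRegularityBounds (h : NSBoundedHigherRegularityBounds) :
    LocalHolderBound := by
  intro a ha c
  obtain ⟨K, C, α, hα, hfact⟩ := h (4 * a) 1 c
  -- the inner ball radius `r = √2 (a/2)` with `Q(a/2) ⊆ Q((0,0), r) ⊆ Q((0,0), 4a)`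
  set r : ℝ := Real.sqrt 2 * (a / 2) with hr_def
  have hs0 : (0 : ℝ) ≤ Real.sqrt 2 := Real.sqrt_nonneg 2
  have hs2 : Real.sqrt 2 ^ 2 = 2 := Real.sq_sqrt (by norm_num)
  have hr0 : 0 < r := by
    have h1 : (1 : ℝ) < Real.sqrt 2 := by nlinarith
    rw [hr_def]; positivity
  have hr4 : r < 4 * a := by
    have h8 : Real.sqrt 2 < 8 := by nlinarith
    rw [hr_def]; nlinarith
  have hr : r ∈ Ioo 0 (4 * a) := ⟨hr0, hr4⟩
  refine ⟨α 0 r, C 0 r, hα 0 r hr, fun u p hsol hbd hp => ?_⟩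
  -- the centre `z₀ = (0, 0)` and the three inclusions
  set z₀ : ℝ × EuclideanSpace ℝ (Fin 3) := 0 with hz₀
  have hA : parabolicCylinder (4 * a) z₀ ⊆ parCyl 0 (4 * a) := by
    rw [hz₀]
    exact _root_.Literature.Analysis.FluidPDE.parabolicCylinder_subset_parCyl _ (4 * a)
  have hB : parCyl 0 (a / 2) ⊆ parabolicCylinder r z₀ := by
    rw [hz₀]
    exact parCyl_subset_parabolicCylinder _ (by positivity : (0 : ℝ) ≤ a / 2)
  have hC : parabolicCylinder r z₀ ⊆ parabolicCylinder (4 * a) z₀ :=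
    parabolicCylinder_mono hr0.le hr4.le _
  -- the hypotheses on the ball cylinder `Q((0,0), 4a)`
  have hle : parabolicCylinderOpens (4 * a) z₀ ≤ parCylOpens 0 (4 * a) := fun w hw => hA hw
  have hsol' : IsDistributionalNSSolutionOn (parabolicCylinderOpens (4 * a) z₀) 1 0 u p :=
    hsol.of_le hle
  have hbd' : ∀ᵐ w ∂(volume.restrict (parabolicCylinder (4 * a) z₀)), ‖u w.1 w.2‖ ≤ 1 :=
    ae_restrict_of_ae_restrict_of_subset hA hbd
  have hp' : ∫⁻ w in parabolicCylinder (4 * a) z₀, ‖p w.1 w.2‖ₑ ^ (3 / 2 : ℝ) ≤ c :=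
    (lintegral_mono_set hA).trans hp
  obtain ⟨V, hae, -, hH⟩ := hfact u p z₀ hsol' hbd' hp'
  obtain ⟨hHold, -⟩ := hH 0 r hr
  have hae' : uncurry u =ᵐ[volume.restrict (parCyl 0 (a / 2))] uncurry V :=
    ae_restrict_of_ae_restrict_of_subset (hB.trans hC) hae
  refine ⟨uncurry V, hae'.symm, ?_⟩
  exact (holderOnWith_uncurry_of_iteratedFDeriv_zero hHold).mono hB

/-! ### The blow-up step, the blow-up alternative and Theorem 3.2 from §2 p. 8 alone -/

/-- **The compactness of the blow-up sequence (`BlowupCompactness`, §4 (p5)–(p11)) from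
`NSBoundedHigherRegularityBounds` alone**: the accepted `blowupCompactness_of_localHolderBound`
(Arzelà–Ascoli, diagonal subsequence, passage to the limit, (p11)) fed with
`localHolderBound_of_higherRegularityBounds`.
[cite: SereginSverak2009, §4 (p5)–(p12) (arXiv p. 11) with §2 p. 8] -/
theorem blowupCompactness_of_higherRegularityBounds (h : NSBoundedHigherRegularityBounds) :
    BlowupCompactness :=
  blowupCompactness_of_localHolderBound (localHolderBound_of_higherRegularityBounds h)

/-- **The blow-up alternative of §4 (`BlowupAlternative`) from `NSBoundedHigherRegularityBounds`
alone**: `blowupAlternative_of_library_facts` fed with the theorem `NSBoundedSpatialHolder_holds`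
(Serrin's spatial regularity, giving the interior continuity of §4 ¶1) and
`localHolderBound_of_higherRegularityBounds`. `BlowupAlternative_holds` is this theorem applied
to `NSBoundedHigherRegularityBounds_holds` once §2 p. 8 is discharged.
[cite: SereginSverak2009, §4 ((p1)–(p11), arXiv p. 11) with §2 p. 8 and Lemma 3.6] -/
theorem blowupAlternative_of_higherRegularityBounds (h : NSBoundedHigherRegularityBounds) :
    BlowupAlternative :=
  blowupAlternative_of_library_facts NSBoundedSpatialHolder_holds
    (localHolderBound_of_higherRegularityBounds h)

/-- **The Type I rendering `BlowupAlternativeTypeI` (the blow-up step for Thm. 3.1) from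
`NSBoundedHigherRegularityBounds` alone**: the accepted
`blowupAlternativeTypeI_of_localHolderBound'` (with `InteriorContinuity_holds`) fed with
`localHolderBound_of_higherRegularityBounds`.
[cite: SereginSverak2009, §4 (proof of Thm. 3.1, arXiv p. 11) with §2 p. 8] -/
theorem blowupAlternativeTypeI_of_higherRegularityBounds (h : NSBoundedHigherRegularityBounds) :
    BlowupAlternativeTypeI :=
  blowupAlternativeTypeI_of_localHolderBound' (localHolderBound_of_higherRegularityBounds h)

/-- **Seregin–Šverák 2009, Theorem 3.2, from `NSBoundedHigherRegularityBounds` alone**: an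
axially symmetric distributional solution in `Q` with `u ∈ L³(Q)`, `p ∈ L^{3/2}(Q)`, (r2) and the
axis decay bound (r4) is regular at the origin — `isRegularAtOrigin_of_axisDecay_of_library_facts`
with `NSBoundedSpatialHolder_holds`, `localHolderBound_of_higherRegularityBounds` and the
discharged Liouville theorem `KNSS2009_liouville_bound_C_over_r_holds` (KNSS 2009, Thm. 5.3).
[cite: SereginSverak2009, Thm. 3.2 and §4 (arXiv pp. 9–11) with §2 p. 8; KochNadirashviliSereginSverak2009, Thm. 5.3] -/
theorem isRegularAtOrigin_of_axisDecay_of_higherRegularityBounds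
    (h : NSBoundedHigherRegularityBounds)
    {u : ℝ → EuclideanSpace ℝ (Fin 3) → EuclideanSpace ℝ (Fin 3)}
    {p : ℝ → EuclideanSpace ℝ (Fin 3) → ℝ} (hsol : IsAxisymmetricLocalSolution u p)
    (hb : IsBoundedAwayFromZero u) (hd : IsAxisDecayOnCyl u) : IsRegularAtOrigin u :=
  isRegularAtOrigin_of_axisDecay_of_library_facts NSBoundedSpatialHolder_holds
    (localHolderBound_of_higherRegularityBounds h) KNSS2009_liouville_bound_C_over_r_holds
    hsol hb hd

end SereginSverak2009

end Literature.Analysis.FluidPDE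

end
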